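import Literature.MathematicalPhysics.QuantumLattice.XYZGroundStateOrderProofs
import Literature.MathematicalPhysics.QuantumLattice.XYZGroundStateOrderGD
import Literature.MathematicalPhysics.QuantumLattice.XYZGroundStateOrderIntegral
import HarnessLib

/-!
# Björnberg–Ueltschi, spin-½ planar window: discharge of `bjornbergUeltschi2022_ground_lro_spinHalf`

Topic `MathematicalPhysics/QuantumLattice`; fourth sibling proof file of `XYZGroundStateOrder.lean`
(item `provefact-Literature.MathematicalPhysics.QuantumLa-089185f5fb`). No statement of the tree is
changed and no definition or named fact is introduced. This file combines

* the assembly `bjornbergUeltschi2022_ground_lro_spinHalf_of_gaussianDomination`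
  (`XYZGroundStateOrderProofs.lean`: B–U Theorem 3.2, second bound, at `β = ∞`, `d = 2`, `S = ½`,
  in the rotated frame `H' = anisotropicTorus 2 L 1 1 J₂ J₁`),
* ground-state Gaussian domination for the anisotropic field Hamiltonian in bond form,
  `xyz_gaussianDomination_real'` (`XYZGroundStateOrderGD.lean`: B–U Lemma 5.2 / Cor. 5.3 at
  `β = ∞`, field on the THIRD component, original frame), and
* the numerical input `klsRiemannSum_two_eventually_le` (`XYZGroundStateOrderIntegral.lean`:
  `R_L(2) ≤ 0.651` eventually, from `Ĩ⁽²⁾ ≤ 15√2/64 + 1/π`),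

into **`bjornbergUeltschi2022_ground_lro_spinHalf_holds`**. The only new content is the transport
of Gaussian domination from the bond form `H'(h) = xyzRealFieldHamiltonian L n J₁ J₂ h` (each bond
once, field on `S²`) to the shape consumed by the assembly (B–U's ordered-pair normalisation,
field on `S⁰` of the rotated Hamiltonian): `2H'(h) = H(J₁,J₂,1) - 2V²_h + Q(h)`
(`two_smul_xyzRealFieldHamiltonian`), the global quarter turn `W = ⨂V` maps this to
`H(1,J₂,J₁) - 2V⁰_h + Q(h)` (`rotV_conj_fieldHamiltonian`), and ground energies are invariant
under unitary conjugation and scale with positive constants (`buSpinHalf_gaussianDomination`).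

## References

* [BjornbergUeltschi2022] J. E. Björnberg, D. Ueltschi, in: The Physics and Mathematics of
  Elliott Lieb, vol. I, EMS Press (2022) 77–108 = arXiv:2204.12896: Thm. 3.2 and p. 11
  ("(3.9) holds when `-J⁽²⁾/J⁽¹⁾ ∈ [0, 0.109]`"), Lemma 4.4, Lemma 5.2, Cor. 5.3, Prop. 2.4.
-/

noncomputable section

open Matrix Finset Filter Topology
open scoped ComplexOrder
open Literature.MathematicalPhysics.QuantumLattice Literature.MathematicalPhysics.QuantumLattice.SpinOperators
  Literature.Probability.LatticeModels

namespace Literature.MathematicalPhysics.QuantumLattice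

variable {d : ℕ}

section Transport

variable (L : ℕ) [NeZero L] (n : ℕ)

/-- **The doubled bond form** (`L ≥ 3`): `2 H'(h) = H(J₁, J₂, 1) - 2 V²_h + Q(h)·1` with
`V²_h = Σ_{x,i} (h_x - h_{x+eᵢ})(S²_x - S²_{x+eᵢ})` and `Q(h) = Σ_{x,i}(h_x - h_{x+eᵢ})²` — B–U's
Hamiltonian (2.4) counts each bond twice, the bond form `xyzRealFieldHamiltonian` once.
[cite: BjornbergUeltschi2022, eqs. (2.4), (5.10)–(5.15)] -/
theorem two_smul_xyzRealFieldHamiltonian (hL : 3 ≤ L) (J₁ J₂ : ℝ) (h : TorusSite d L → ℝ) :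
    (2 : ℂ) • xyzRealFieldHamiltonian L n J₁ J₂ h =
      anisotropicTorus d L n J₁ J₂ 1 -
        (2 : ℂ) • (∑ x : TorusSite d L, ∑ i : Fin d,
          ((h x - h (x + Pi.single i 1) : ℝ) : ℂ) •
            (siteSpin n x 2 - siteSpin n (x + Pi.single i 1) 2 : Op (TorusSite d L) (n + 1))) +
        ((xyFieldEnergy L h : ℝ) : ℂ) • (1 : Op (TorusSite d L) (n + 1)) := by
  have hpairs := sum_pairs_eq_sum_edgeFinset' L hL
    (fun e => Sym2.lift ⟨fun x y => xyzRealBond n J₁ J₂ h x y, fun _ _ => xyzRealBond_comm n J₁ J₂ h _ _⟩ e)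
  simp only [Sym2.lift_mk] at hpairs
  rw [xyzRealFieldHamiltonian, ← hpairs, anisotropicTorus_eq_pairSum L n hL, xyFieldEnergy,
    Complex.ofReal_sum, Finset.sum_smul, Finset.smul_sum, Finset.smul_sum, Finset.smul_sum, ← sum_neg_distrib,
    ← sum_sub_distrib, ← sum_add_distrib]
  refine sum_congr rfl fun x _ => ?_
  rw [Complex.ofReal_sum, Finset.sum_smul, Finset.smul_sum, Finset.smul_sum, Finset.smul_sum,
    ← sum_neg_distrib, ← sum_sub_distrib, ← sum_add_distrib]
  refine sum_congr rfl fun i _ => ?_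
  simp only [xyzRealBond]
  push_cast
  module

/-- **The global quarter turn transports the field Hamiltonian**: with `W = ⨂V`
(`V Sᶻ Vᴴ = Sˣ`), `W (H(J₁,J₂,1) - 2V²_h + Q·1) Wᴴ = H(1,J₂,J₁) - 2V⁰_h + Q·1`, where
`V⁰_h = xyGradField` is the field term on the first component. [cite: BjornbergUeltschi2022, Prop. 2.4] -/
theorem rotV_conj_fieldHamiltonian {V : Matrix (Fin (n + 1)) (Fin (n + 1)) ℂ} (hV : V * Vᴴ = 1)
    (hV' : Vᴴ * V = 1) (hVz : V * SpinOperators.spinZ n * Vᴴ = spinX n)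
    (hVx : V * spinX n * Vᴴ = -SpinOperators.spinZ n) (hVy : V * spinY n * Vᴴ = spinY n)
    (J₁ J₂ : ℝ) (h : TorusSite d L → ℝ) (Q : ℝ) :
    productOp (fun _ : TorusSite d L => V) *
        (anisotropicTorus d L n J₁ J₂ 1 -
          (2 : ℂ) • (∑ x : TorusSite d L, ∑ i : Fin d,
            ((h x - h (x + Pi.single i 1) : ℝ) : ℂ) •
              (siteSpin n x 2 - siteSpin n (x + Pi.single i 1) 2 : Op (TorusSite d L) (n + 1))) +
          (Q : ℂ) • (1 : Op (TorusSite d L) (n + 1))) *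
        (productOp (fun _ : TorusSite d L => V))ᴴ =
      anisotropicTorus d L n 1 J₂ J₁ - (2 : ℂ) • xyGradField L n h +
        (Q : ℂ) • (1 : Op (TorusSite d L) (n + 1)) := by
  set W : Op (TorusSite d L) (n + 1) := productOp (fun _ : TorusSite d L => V) with hW
  have hua : ∀ _z : TorusSite d L, V * Vᴴ = 1 := fun _ => hV
  have hW1 : W * (1 : Op (TorusSite d L) (n + 1)) * Wᴴ = 1 := by
    rw [Matrix.mul_one, hW, productOp_mul_conjTranspose hua]
  have hS : ∀ x : TorusSite d L, W * siteSpin n x 2 * Wᴴ = siteSpin n x 0 := by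
    intro x
    rw [hW, productOp_conj_siteSpin hua, spinVec_two, hVz]
    rfl
  have hA : W * anisotropicTorus d L n J₁ J₂ 1 * Wᴴ = anisotropicTorus d L n 1 J₂ J₁ := by
    rw [hW]
    exact rotV_conj_anisotropicTorus L n hV hV' hVz hVx hVy J₁ J₂ 1
  have hB : W * (∑ x : TorusSite d L, ∑ i : Fin d,
      ((h x - h (x + Pi.single i 1) : ℝ) : ℂ) •
        (siteSpin n x 2 - siteSpin n (x + Pi.single i 1) 2 : Op (TorusSite d L) (n + 1))) * Wᴴ =
      xyGradField L n h := by
    rw [xyGradField, Finset.mul_sum, Finset.sum_mul]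
    refine sum_congr rfl fun x _ => ?_
    rw [Finset.mul_sum, Finset.sum_mul]
    refine sum_congr rfl fun i _ => ?_
    rw [Matrix.mul_smul, Matrix.smul_mul, Matrix.mul_sub, Matrix.sub_mul, hS, hS]
  rw [Matrix.mul_add, Matrix.add_mul, Matrix.mul_sub, Matrix.sub_mul, Matrix.mul_smul, Matrix.smul_mul,
    Matrix.mul_smul, Matrix.smul_mul, hA, hB, hW1]

/-- **Gaussian domination in the shape consumed by the assembly** (B–U Cor. 5.3 / (5.20) at
`β = ∞`, transported): on even tori of side `L ≥ 4`, for `0 ≤ J₁`, `J₂ ≤ 0`, all spins and all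
real fields `h`, `E₀(H(1,J₂,J₁)) ≤ E₀(H(1,J₂,J₁) - 2V⁰_h + Q(h))`:
`E₀(H(1,J₂,J₁) - 2V⁰_h + Q(h)) = E₀(H(J₁,J₂,1) - 2V²_h + Q(h)) = 2E₀(H'(h)) ≥ 2E₀(H'(0)) = E₀(H(1,J₂,J₁))`.
[cite: BjornbergUeltschi2022, Cor. 5.3 and (5.20)] -/
theorem buSpinHalf_gaussianDomination (hL : Even L) (h4 : 4 ≤ L) {J₁ J₂ : ℝ} (hJ₁ : 0 ≤ J₁)
    (hJ₂ : J₂ ≤ 0) (h : TorusSite d L → ℝ) :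
    (anisotropicTorus d L n 1 J₂ J₁).groundEnergy ≤
      (anisotropicTorus d L n 1 J₂ J₁ - (2 : ℂ) • xyGradField L n h +
        ((xyFieldEnergy L h : ℝ) : ℂ) • 1).groundEnergy := by
  have hL3 : 3 ≤ L := by omega
  obtain ⟨V, hV, hV', hVz, hVx, hVy⟩ := exists_unitary_conj_spinZ_eq_spinX n
  set W : Op (TorusSite d L) (n + 1) := productOp (fun _ : TorusSite d L => V) with hW
  have hWu : W ∈ Matrix.unitaryGroup (TensorIndex (TorusSite d L) (n + 1)) ℂ :=
    Matrix.mem_unitaryGroup_iff.2 (productOp_mul_conjTranspose fun _ => hV)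
  have key : ∀ g : TorusSite d L → ℝ,
      (anisotropicTorus d L n 1 J₂ J₁ - (2 : ℂ) • xyGradField L n g +
          ((xyFieldEnergy L g : ℝ) : ℂ) • 1).groundEnergy =
        2 * (xyzRealFieldHamiltonian L n J₁ J₂ g).groundEnergy := by
    intro g
    rw [← rotV_conj_fieldHamiltonian L n hV hV' hVz hVx hVy J₁ J₂ g (xyFieldEnergy L g),
      Matrix.groundEnergy_unitary_conj hWu, ← two_smul_xyzRealFieldHamiltonian L n hL3,
      show (2 : ℂ) = ((2 : ℝ) : ℂ) by norm_num,
      Matrix.groundEnergy_smul_of_pos (xyzRealFieldHamiltonian_isHermitian L n J₁ J₂ g) two_pos]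
  have h0 : anisotropicTorus d L n 1 J₂ J₁ =
      anisotropicTorus d L n 1 J₂ J₁ - (2 : ℂ) • xyGradField L n (fun _ : TorusSite d L => (0 : ℝ)) +
        ((xyFieldEnergy L (fun _ : TorusSite d L => (0 : ℝ)) : ℝ) : ℂ) • 1 := by
    simp [xyGradField, xyFieldEnergy]
  calc (anisotropicTorus d L n 1 J₂ J₁).groundEnergy
      = (anisotropicTorus d L n 1 J₂ J₁ - (2 : ℂ) • xyGradField L n (fun _ : TorusSite d L => (0 : ℝ)) +
          ((xyFieldEnergy L (fun _ : TorusSite d L => (0 : ℝ)) : ℝ) : ℂ) • 1).groundEnergy := by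
        rw [← h0]
    _ = 2 * (xyzRealFieldHamiltonian L n J₁ J₂ (fun _ => 0)).groundEnergy := key _
    _ ≤ 2 * (xyzRealFieldHamiltonian L n J₁ J₂ h).groundEnergy :=
        mul_le_mul_of_nonneg_left (xyz_gaussianDomination_real' L n hL h4 hJ₁ hJ₂ h) two_pos.le
    _ = _ := (key h).symm

end Transport

/-- **Björnberg–Ueltschi 2022, the spin-½ planar window** (discharge of
`bjornbergUeltschi2022_ground_lro_spinHalf`): for `d = 2`, `S = ½`, `J⁽³⁾ = 1 ≥ J⁽¹⁾ > 0` and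
`0 ≤ -J⁽²⁾ ≤ 0.109 J⁽¹⁾`, the ground states of
`H = -Σ_{x∼y}(J⁽¹⁾S⁽¹⁾S⁽¹⁾ + J⁽²⁾S⁽²⁾S⁽²⁾ + S⁽³⁾S⁽³⁾)` on the even tori `(ℤ/2kℤ)²` have long-range
order in the third direction. Inputs: reflection positivity ⇒ ground-state Gaussian domination
(`XYZGroundStateOrderGD.lean`) ⇒ the `T = 0` infrared bound; the sum rule, the variational bound
with the polarised state, Kubo's orbit inequalities and B–U (4.42); the certified analytic bound
`Ĩ⁽²⁾ ≤ 15√2/64 + 1/π = 0.6498` on B–U's integral (Table 1: `0.6468`) in place of the numerical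
table (`XYZGroundStateOrderIntegral.lean`), assembled in `XYZGroundStateOrderProofs.lean`.
[cite: BjornbergUeltschi2022, Thm. 3.2 and p. 11] -/
theorem bjornbergUeltschi2022_ground_lro_spinHalf_holds : bjornbergUeltschi2022_ground_lro_spinHalf :=
  bjornbergUeltschi2022_ground_lro_spinHalf_of_gaussianDomination
    (fun L _ hL h4 _J₁ _J₂ hJ₁ hJ₂ h => buSpinHalf_gaussianDomination L 1 hL h4 hJ₁ hJ₂ h)
    klsRiemannSum_two_eventually_le

end Literature.MathematicalPhysics.QuantumLattice
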